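import Summits.HodgeConjecture.HodgeConjecture.Theorems.R90S6BCGraphPartner   -- ★ W7-b (ii) `bcGraphPartnerAlgHom` (p09) = print's `ψ̂_G = b` in graph currency (brings the Satake estate)
import HarnessLib

/-!
# R90 · S6 «Ch. 14.1–14.5 stable TF» — WAVE 10 card W10-c: THE BASE-CHANGE PARTNER `b = ψ̂_G` ON THE GENERATORS `T₁, T₂, T₃^{±1}` OF
# `ℋ(GL₃(K), GL₃(𝒪))` (`Theorems/R90S6BCPartnerOnGenerators.lean`; DAG r5 row E1.4.4.2.3, coefficient layer)

Cell `hodgecm-mathlib`, crux H413 (`stmt-HodgeConjecture-24833`), route of record `HCCMUnconditional`; programme R90-TF, section S6 (base `R90-C14`),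
seat R90-C14-p06 (g0); S6 dealer R90-C14-plan (g2) CARD W10-c (R90 bus 2026-09-05T00:19:31Z «ψ̂_G = b ON THE GL₃ GENERATORS»), census + heads of
record `R90/R90-C14-p06/g0/CENSUS-W10c.v1.md` (R90 bus 00:26Z; dealer R1–R2 «=» 00:27:01Z: (G.0) engine stays in this Theorems file — «candidate for promotion to
`Literature/…/SatakeIsomorphismGLNormalisations`»; keep BOTH (B.1) and (B.1′); API-module exception granted; AUDIT BOX heads CLEAN 00:28:58Z).  Lane
`--supports stmt-HodgeConjecture-24833 --as helper`; THEOREMS ONLY (no definition, no instance, no notation, no named fact, no `sorry`); letters = ★ p09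
(g0)'s `Theorems/R90S6BCGraphPartner.lean` VERBATIM (generic DVR field `K`, `hϖ`, `hu : u² = #𝓀[K]`, `hwt : wt = u^{(n−1)|·| − 2⟨ν,·⟩}` = the unitary
`δ^{1∕2} CT^{cl}` normalisation); imports = ★ `R90S6BCGraphPartner` + HarnessLib (no `Cruxes` import).

CONTENT.  `T_r := heckeAlgebra.doubleCosetOperator (glInt n K) (heckeDiag n ϖ r)` = `1_{K diag(ϖ·1_r, 1_{n−r}) K}` (★ `heckeDiag`).
§1 GL ENGINE (generic `n`, any torus parameter `zz`): **`λ^{wt}_{zz}(T_r) = q^{−r(r−1)∕2} · u^{(n−1)r} · e_r(zz)`** (`q = #𝓀[K] = u²`, so the scalar is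
`q^{r(n−r)∕2}` — Tamagawa ∕ Shimura Thm. 3.21) from ★ `satakeTransform_deltaHalf_eq_monomialTwist_satakeTransformModP` (`𝒮_wt = monomialTwist (u^{(n−1)|·|}) ∘ 𝒮_R`)
+ ★ `satakeTransformModP_doubleCosetOperator_heckeDiag` (`𝒮_R(T_r) = q^{−r(r−1)∕2} Σ_{|t| = r} x^{𝟙_t}`) + ★ `monomialTwist_single` + `AddMonoidAlgebra.lift_single`.
§2 THE BASE-CHANGE LINE at `n = 3`, `zz = (z, 1, z⁻¹)` (FILE D's `rogawskiParamBC z`): `e₁ = e₂ = z + 1 + z⁻¹`, `e₃ = 1`, hence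
`λ_{(z,1,z⁻¹)}(T₁) = λ_{(z,1,z⁻¹)}(T₂) = q·(z + 1 + z⁻¹)` and `λ_{(z,1,z⁻¹)}(T₃) = 1`.
§3 THE PARTNER (★ `bcGraphPartnerAlgHom` = print's `ψ̂_G : ℋ(G̃, ω̃) → ℋ(G, ω)`, [Rogawski1990, §4.10 Prop. 4.10.1 (a), 4.10.2], characterised by
★ `eq_bcGraphPartnerAlgHom_of_graph`): with the NORMALISED `U(J₀,3)` generator `T₁ᵁ` (`𝒮_w(T₁ᵁ) = x^{(1,0,−1)} + x^{(−1,0,1)}`, `λ_{(z,1,1)}(T₁ᵁ) = z + z⁻¹`,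
inhabited by ★ `exists_generator_unitaryHeckeAlgebraAdic_three`): **`b T₁ = q • T₁ᵁ + q • 1`**; in the RAW letters of the junction `K = L_w`
(`hqQ : (#𝓀[K] : ℂ) = #𝓀[E_w]`, dischargeable by ★ `natCard_residueField_eq_of_compatible`; `φ₁ = 1_{K₀ t K₀}` the basic operator of ★
`heckeEigencharacter_doubleCosetOperator_basic_three`, `λ_{(z,1,1)}(φ₁) = Q(z + z⁻¹) + √Q − 1`): **`b T₁ = φ₁ + (Q − √Q + 1) • 1`**;
**`b T₂ = b T₁`** (same line values — `ψ̂_G` is not injective, `ℋ(GL₃) = ℂ[e₁, e₂, e₃^{±1}] ↠ ℂ[z + z⁻¹]`); **`b T₃ = 1`**, **`b T₃⁻¹ = 1`**.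
PROOF HYGIENE (for the next hand on these carriers): all `U(3)`-side algebra is done with the EXPLICIT `RingHom`∕`LinearMap` laws of the eigencharacter
(`(λ).toRingHom.map_add`, `(λ).toLinearMap.map_smul`, as ★ p09 `bcGraphPartner_add`) and the first `GL₃` rewrite is applied as a TERM (`.trans`): the generic
`map_add`∕`map_smul` class searches and `rw`'s `kabstract` at default transparency both time out on these carriers.

* §1 `glHeckeEigencharacter_heckeDiag` — (G.0) the engine (generic `n`, `r ≤ n`, any `zz`);
* §2 `glHeckeEigencharacter_bcLine_heckeDiag_one` ∕ `_two` ∕ `_three` — (G.1)–(G.3);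
* §3 `bcGraphPartnerAlgHom_heckeDiag_one` (B.1), `bcGraphPartnerAlgHom_heckeDiag_one_eq_basic` (B.1′), `bcGraphPartnerAlgHom_heckeDiag_two` (B.2: `= b T₁`),
  `bcGraphPartnerAlgHom_heckeDiag_three` (B.3), `bcGraphPartnerAlgHom_heckeDiag_three_inv` (B.3′).

HONEST LABEL: local spherical Hecke bookkeeping; proves no printed global statement; count-neutral until E1.4.4.2.3 (the coefficients `c_{λ,m}` of `b(φ_λ)`)
consumes it.  HC_CM is proved only modulo the 7 printed citations (2 remaining named inputs: hLiu418 = stmt-HodgeConjecture-24832, h413 = stmt-HodgeConjecture-24833)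
until rung 0 closes; REL ≠ ★ ≠ BUILT.

## References
* [ShimuraIATAF1971] G. Shimura, *Introduction to the arithmetic theory of automorphic functions* (1971), Thm. 3.21 (`ω(T_r)`, Tamagawa's computation).
* [CartierCorvallis1979] P. Cartier, *Representations of 𝔭-adic groups: a survey*, PSPM 33.1 (1979), §IV (4.2)–(4.4), §IV.2 Example.
* [Rogawski1990] J. D. Rogawski, *Automorphic Representations of Unitary Groups in Three Variables*, Ann. of Math. Stud. 123 (1990), §4.10 Prop. 4.10.1 (a),
  Prop. 4.10.2 pp. 57–58 (print fixes no explicit value of `ψ̂_G(T_r)`; it works through the parameters `χ ∘ N ↔ χ` only).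
-/

set_option autoImplicit false
-- the mandated namespace repeats the single-problem summit's segment (`HodgeConjecture.HodgeConjecture`)
set_option linter.dupNamespace false

noncomputable section

open NumberField IsDedekindDomain Polynomial
open Literature.NumberTheory.Automorphic Literature.NumberTheory.Automorphic.HermitianLattice Literature.NumberTheory.Automorphic.UnitaryGroup
open Literature.NumberTheory.Automorphic.CartanUnique
open scoped MatrixGroups
open ValuativeRel Finset

namespace Summit.HodgeConjecture.HodgeConjecture.R90.S6

universe u

/-! ## §1 The `GL_n` engine: `λ^{wt}_{zz}(T_r)` -/

section Engine

variable {n : ℕ} {K : Type u} [Field K] [ValuativeRel K] [IsDiscreteValuationRing 𝒪[K]] [Finite 𝓀[K]] {ϖ : K}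
  [IsHeckeTriple (⊤ : Submonoid (GL (Fin n) K)) (glInt n K) (glInt n K)]
  (hϖ : IsUniformizingElement ϖ) {u : ℂˣ} (hu : (u : ℂ) ^ 2 = ((Nat.card 𝓀[K] : ℕ) : ℂ))
  {wt : Multiplicative (Fin n → ℤ) →* ℂ}
  (hwt : ∀ e : Fin n → ℤ, wt (Multiplicative.ofAdd e) = ((u ^ (((n : ℤ) - 1) * (∑ i, e i) - 2 * satakeTwistExp e) : ℂˣ) : ℂ))

include hu hwt in
/-- **(G.0) THE `GL_n` ENGINE: the unitarily normalised Hecke eigencharacter of `T_r`** (`r ≤ n`, any torus parameter `zz ∈ (ℂˣ)ⁿ`):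
`λ^{wt}_{zz}(T_r) = q^{−r(r−1)∕2} · u^{(n−1)r} · e_r(zz)`, `e_r(zz) = Σ_{|t| = r} ∏_{i ∈ t} zz_i` (with `u² = q` the scalar is `q^{r(n−r)∕2}`: Shimura Thm. 3.21 ∕
Tamagawa; Cartier §IV.2 Example).  ★ `satakeTransform_deltaHalf_eq_monomialTwist_satakeTransformModP` + ★ `satakeTransformModP_doubleCosetOperator_heckeDiag`.
Candidate for promotion to `Literature/…/SatakeIsomorphismGLNormalisations` (dealer R1, 2026-09-05). [cite: ShimuraIATAF1971, Thm. 3.21] [cite: CartierCorvallis1979, §IV (4.2)] -/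
theorem glHeckeEigencharacter_heckeDiag (zz : Fin n → ℂˣ) {r : ℕ} (hr : r ≤ n) :
    (isIwasawaExponent_gl hϖ).heckeEigencharacter wt (laurentMonomialHom zz)
        (heckeAlgebra.doubleCosetOperator (glInt n K) (heckeDiag n (Units.mk0 ϖ hϖ.ne_zero) r)) =
      (((Nat.card 𝓀[K] : ℕ) : ℂ)⁻¹) ^ (r * (r - 1) / 2) * ((u ^ (((n : ℤ) - 1) * r) : ℂˣ) : ℂ) *
        ∑ t ∈ powersetCard r (univ : Finset (Fin n)), ∏ i ∈ t, (zz i : ℂ) := by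
  obtain ⟨c, hc⟩ := exists_monoidHom_apply_ofAdd_eq_zpow_sum (n := n) u
  rw [IsIwasawaExponent.heckeEigencharacter_apply,
    satakeTransform_deltaHalf_eq_monomialTwist_satakeTransformModP hϖ hu hwt hc,
    satakeTransformModP_doubleCosetOperator_heckeDiag hϖ (isUnit_natCard_of_sq_eq hu) hr, map_smul, map_sum, map_smul,
    map_sum, Finset.mul_sum, Finset.smul_sum]
  refine Finset.sum_congr rfl fun t ht => ?_
  rw [monomialTwist_single, one_mul, AddMonoidAlgebra.lift_single, hc, smul_eq_mul, smul_eq_mul]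
  -- `|𝟙_t| = #t = r`
  have hsum : (∑ i : Fin n, (if i ∈ t then (1 : ℤ) else 0)) = (r : ℤ) := by
    rw [Finset.sum_ite_mem, Finset.univ_inter, Finset.sum_const, (Finset.mem_powersetCard.1 ht).2, nsmul_eq_mul, mul_one]
  -- `χ_zz(𝟙_t) = ∏_{i ∈ t} zz_i`
  have hmon : laurentMonomialHom zz (Multiplicative.ofAdd fun i => if i ∈ t then (1 : ℤ) else 0) = ∏ i ∈ t, (zz i : ℂ) := by
    have h := laurentEvalAt_single zz (fun i => if i ∈ t then (1 : ℤ) else 0) 1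
    rw [laurentEvalAt, AddMonoidAlgebra.lift_single, one_smul, one_mul] at h
    rw [h, show (∏ i, (zz i : ℂ) ^ (if i ∈ t then (1 : ℤ) else 0)) = ∏ i, (if i ∈ t then (zz i : ℂ) else 1) from
      Finset.prod_congr rfl fun i _ => by split_ifs <;> simp, Finset.prod_ite_mem, Finset.univ_inter]
  rw [hsum, hmon, Units.val_pow_eq_pow_val, Units.val_inv_eq_inv_val, IsUnit.unit_spec, mul_assoc]


end Engine

/-! ## §2 The base-change line at `n = 3`: `zz = (z, 1, z⁻¹)` -/

section Three

/-- `e₁(z, 1, z⁻¹) = z + 1 + z⁻¹`, in the engine's `powersetCard` form. [folklore] -/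
private theorem sum_powersetCard_one_bcLine (z : ℂˣ) :
    (∑ t ∈ powersetCard 1 (univ : Finset (Fin 3)), ∏ i ∈ t, (((![z, 1, z⁻¹] : Fin 3 → ℂˣ) i : ℂˣ) : ℂ)) =
      (z : ℂ) + 1 + (z : ℂ)⁻¹ := by
  rw [Finset.powersetCard_one, Finset.sum_map]
  simp only [Function.Embedding.coeFn_mk, Finset.prod_singleton, Fin.sum_univ_three, Matrix.cons_val_zero, Matrix.cons_val_one,
    Matrix.cons_val_two, Matrix.head_cons, Matrix.tail_cons, Units.val_one, Units.val_inv_eq_inv_val]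

/-- `e₂(z, 1, z⁻¹) = z·1 + z·z⁻¹ + 1·z⁻¹ = z + 1 + z⁻¹`, in the engine's `powersetCard` form. [folklore] -/
private theorem sum_powersetCard_two_bcLine (z : ℂˣ) :
    (∑ t ∈ powersetCard 2 (univ : Finset (Fin 3)), ∏ i ∈ t, (((![z, 1, z⁻¹] : Fin 3 → ℂˣ) i : ℂˣ) : ℂ)) =
      (z : ℂ) + 1 + (z : ℂ)⁻¹ := by
  have hz : (z : ℂ) ≠ 0 := z.ne_zero
  rw [show powersetCard 2 (univ : Finset (Fin 3)) = {{0, 1}, {0, 2}, {1, 2}} from by decide,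
    Finset.sum_insert (by decide), Finset.sum_insert (by decide), Finset.sum_singleton,
    Finset.prod_insert (by decide), Finset.prod_insert (by decide), Finset.prod_insert (by decide),
    Finset.prod_singleton, Finset.prod_singleton]
  simp only [Matrix.cons_val_zero, Matrix.cons_val_one, Matrix.cons_val_two, Matrix.head_cons, Matrix.tail_cons, Units.val_one,
    Units.val_inv_eq_inv_val, mul_inv_cancel₀ hz]
  ring

/-- `e₃(z, 1, z⁻¹) = z·1·z⁻¹ = 1`, in the engine's `powersetCard` form. [folklore] -/
private theorem sum_powersetCard_three_bcLine (z : ℂˣ) :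
    (∑ t ∈ powersetCard 3 (univ : Finset (Fin 3)), ∏ i ∈ t, (((![z, 1, z⁻¹] : Fin 3 → ℂˣ) i : ℂˣ) : ℂ)) = 1 := by
  rw [show powersetCard 3 (univ : Finset (Fin 3)) = {univ} from by simpa using Finset.powersetCard_self (univ : Finset (Fin 3)),
    Finset.sum_singleton, Fin.prod_univ_three]
  simp only [Matrix.cons_val_zero, Matrix.cons_val_one, Matrix.cons_val_two, Matrix.head_cons, Matrix.tail_cons, Units.val_one,
    Units.val_inv_eq_inv_val, mul_one]
  exact mul_inv_cancel₀ z.ne_zero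

variable {K : Type u} [Field K] [ValuativeRel K] [IsDiscreteValuationRing 𝒪[K]] [Finite 𝓀[K]] {ϖ : K}
  [IsHeckeTriple (⊤ : Submonoid (GL (Fin 3) K)) (glInt 3 K) (glInt 3 K)]
  (hϖ : IsUniformizingElement ϖ) {u : ℂˣ} (hu : (u : ℂ) ^ 2 = ((Nat.card 𝓀[K] : ℕ) : ℂ))
  {wt : Multiplicative (Fin 3 → ℤ) →* ℂ}
  (hwt : ∀ e : Fin 3 → ℤ, wt (Multiplicative.ofAdd e) = ((u ^ ((((3 : ℕ) : ℤ) - 1) * (∑ i, e i) - 2 * satakeTwistExp e) : ℂˣ) : ℂ))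

include hu hwt

/-- **(G.1)** `λ^{GL₃}_{(z,1,z⁻¹)}(T₁) = q·(z + 1 + z⁻¹)` (`q = #𝓀[K]`; engine at `r = 1`: `u² e₁(z,1,z⁻¹)`). [cite: ShimuraIATAF1971, Thm. 3.21]
[cite: CartierCorvallis1979, §IV (4.2)] -/
theorem glHeckeEigencharacter_bcLine_heckeDiag_one (z : ℂˣ) :
    (isIwasawaExponent_gl hϖ).heckeEigencharacter wt (laurentMonomialHom ![z, 1, z⁻¹])
        (heckeAlgebra.doubleCosetOperator (glInt 3 K) (heckeDiag 3 (Units.mk0 ϖ hϖ.ne_zero) 1)) =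
      ((Nat.card 𝓀[K] : ℕ) : ℂ) * ((z : ℂ) + 1 + (z : ℂ)⁻¹) := by
  rw [glHeckeEigencharacter_heckeDiag (n := 3) hϖ hu hwt ![z, 1, z⁻¹] (r := 1) (by norm_num), sum_powersetCard_one_bcLine,
    show (((3 : ℕ) : ℤ) - 1) * ((1 : ℕ) : ℤ) = ((2 : ℕ) : ℤ) by norm_num, zpow_natCast, Units.val_pow_eq_pow_val, hu]
  norm_num

/-- **(G.2)** `λ^{GL₃}_{(z,1,z⁻¹)}(T₂) = q·(z + 1 + z⁻¹)` — the SAME value as `T₁` on the base-change line (engine at `r = 2`: `q⁻¹ u⁴ e₂ = q e₂`, and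
`e₂(z,1,z⁻¹) = e₁(z,1,z⁻¹)`). [cite: ShimuraIATAF1971, Thm. 3.21] [cite: CartierCorvallis1979, §IV (4.2)] -/
theorem glHeckeEigencharacter_bcLine_heckeDiag_two (z : ℂˣ) :
    (isIwasawaExponent_gl hϖ).heckeEigencharacter wt (laurentMonomialHom ![z, 1, z⁻¹])
        (heckeAlgebra.doubleCosetOperator (glInt 3 K) (heckeDiag 3 (Units.mk0 ϖ hϖ.ne_zero) 2)) =
      ((Nat.card 𝓀[K] : ℕ) : ℂ) * ((z : ℂ) + 1 + (z : ℂ)⁻¹) := by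
  have hq : ((Nat.card 𝓀[K] : ℕ) : ℂ) ≠ 0 := natCard_residueField_ne_zero
  rw [glHeckeEigencharacter_heckeDiag (n := 3) hϖ hu hwt ![z, 1, z⁻¹] (r := 2) (by norm_num), sum_powersetCard_two_bcLine,
    show (((3 : ℕ) : ℤ) - 1) * ((2 : ℕ) : ℤ) = ((4 : ℕ) : ℤ) by norm_num, zpow_natCast, Units.val_pow_eq_pow_val,
    show (u : ℂ) ^ 4 = ((u : ℂ) ^ 2) ^ 2 by ring, hu]
  field_simp
  norm_num

/-- **(G.3)** `λ^{GL₃}_{(z,1,z⁻¹)}(T₃) = 1` (`T₃` = the central operator `1_{K ϖK}`; engine at `r = 3`: `q⁻³ u⁶ e₃ = e₃(z,1,z⁻¹) = 1`).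
[cite: ShimuraIATAF1971, Thm. 3.21] [cite: CartierCorvallis1979, §IV (4.2)] -/
theorem glHeckeEigencharacter_bcLine_heckeDiag_three (z : ℂˣ) :
    (isIwasawaExponent_gl hϖ).heckeEigencharacter wt (laurentMonomialHom ![z, 1, z⁻¹])
        (heckeAlgebra.doubleCosetOperator (glInt 3 K) (heckeDiag 3 (Units.mk0 ϖ hϖ.ne_zero) 3)) = 1 := by
  have hq : ((Nat.card 𝓀[K] : ℕ) : ℂ) ≠ 0 := natCard_residueField_ne_zero
  rw [glHeckeEigencharacter_heckeDiag (n := 3) hϖ hu hwt ![z, 1, z⁻¹] (r := 3) le_rfl, sum_powersetCard_three_bcLine,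
    show (((3 : ℕ) : ℤ) - 1) * ((3 : ℕ) : ℤ) = ((6 : ℕ) : ℤ) by norm_num, zpow_natCast, Units.val_pow_eq_pow_val,
    show (u : ℂ) ^ 6 = ((u : ℂ) ^ 2) ^ 3 by ring, hu]
  field_simp
  norm_num

end Three

/-! ## §3 The base-change partner `b = ψ̂_G` on the generators -/

/-- Pure algebra: an algebra homomorphism that sends `x` to `1` sends any right inverse `y` of `x` to `1`. [folklore] -/
private theorem map_eq_one_of_mul_eq_one {A B : Type*} [Semiring A] [Semiring B] [Algebra ℂ A] [Algebra ℂ B] (f : A →ₐ[ℂ] B)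
    {x y : A} (hxy : x * y = 1) (hx : f x = 1) : f y = 1 :=
  calc f y = f x * f y := by rw [hx, one_mul]
    _ = f (x * y) := (map_mul f x y).symm
    _ = 1 := by rw [hxy, map_one]

section Partner

variable {F E : Type} [Field F] [NumberField F] [Field E] [NumberField E] [Algebra F E] [Algebra.IsQuadraticExtension F E]
  (c : E ≃ₐ[F] E) (hc1 : c ≠ 1) (v : HeightOneSpectrum (𝓞 F)) (w : PlacesOver E v) (hw : c • w.1 = w.1)
  (hv : Algebra.IsUnramifiedIn (𝓞 E) v.asIdeal)
  {K : Type u} [Field K] [ValuativeRel K] [IsDiscreteValuationRing 𝒪[K]] [Finite 𝓀[K]] {ϖ : K}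
  [IsHeckeTriple (⊤ : Submonoid (GL (Fin 3) K)) (glInt 3 K) (glInt 3 K)]
  (hϖ : IsUniformizingElement ϖ) {u : ℂˣ} (hu : (u : ℂ) ^ 2 = ((Nat.card 𝓀[K] : ℕ) : ℂ))
  {wt : Multiplicative (Fin 3 → ℤ) →* ℂ}
  (hwt : ∀ e : Fin 3 → ℤ, wt (Multiplicative.ofAdd e) = ((u ^ ((((3 : ℕ) : ℤ) - 1) * (∑ i, e i) - 2 * satakeTwistExp e) : ℂˣ) : ℂ))

/-- **(B.1) `b T₁ = q • T₁ᵁ + q • 1`** for the normalised `U(J₀,3)` generator `T₁ᵁ` (`𝒮_w(T₁ᵁ) = x^{(1,0,−1)} + x^{(−1,0,1)}`, so `λ_{(z,1,1)}(T₁ᵁ) = z + z⁻¹`;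
inhabited by ★ `exists_generator_unitaryHeckeAlgebraAdic_three`): both sides of the graph `λ^{GL₃}_{(z,1,z⁻¹)}(T₁) = λ^{U(3)}_{(z,1,1)}(·)` equal `q(z + 1 + z⁻¹)`,
and the partner is unique (★ `eq_bcGraphPartnerAlgHom_of_graph`).  `q = #𝓀[K]` is the `GL₃`-side residue cardinality; no `U(3)`-side constant enters.
[cite: Rogawski1990, §4.10 Prop. 4.10.2 p. 58] [cite: CartierCorvallis1979, §IV Cor. 4.2] -/
theorem bcGraphPartnerAlgHom_heckeDiag_one
    {T₁ : heckeAlgebra ℂ ↥(unitaryGroupOfForm (galAdicCompletionMap (L := E) c hw) ((StdForm.antidiagonal 3).over (w.1.adicCompletion E)))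
      (unitaryInt (galAdicCompletionMap (L := E) c hw) ((StdForm.antidiagonal 3).over (w.1.adicCompletion E)))}
    (hT₁ : unitarySatakeTransformAdic c hc1 v w hw hv T₁ =
      AddMonoidAlgebra.single (fun i : Fin 3 => (1 : ℤ) * (1 - (i : ℕ))) (1 : ℂ) +
        AddMonoidAlgebra.single (fun i : Fin 3 => (-1 : ℤ) * (1 - (i : ℕ))) 1) :
    bcGraphPartnerAlgHom c hc1 v w hw hv hϖ hu hwt
        (heckeAlgebra.doubleCosetOperator (glInt 3 K) (heckeDiag 3 (Units.mk0 ϖ hϖ.ne_zero) 1)) =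
      ((Nat.card 𝓀[K] : ℕ) : ℂ) • T₁ + ((Nat.card 𝓀[K] : ℕ) : ℂ) • 1 := by
  refine (eq_bcGraphPartnerAlgHom_of_graph c hc1 v w hw hv hϖ hu hwt _ _ fun z => ?_).symm
  have hT : unitaryHeckeEigencharacterAdic c hc1 v w hw hv ![z, 1, 1] T₁ = (z : ℂ) + (z : ℂ)⁻¹ := by
    have h := unitaryHeckeEigencharacterAdic_three_aeval c hc1 v w hw hv hT₁ X z
    rwa [aeval_X, eval_X] at h
  have hs : ∀ x, unitaryHeckeEigencharacterAdic c hc1 v w hw hv ![z, 1, 1] (((Nat.card 𝓀[K] : ℕ) : ℂ) • x) =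
      ((Nat.card 𝓀[K] : ℕ) : ℂ) • unitaryHeckeEigencharacterAdic c hc1 v w hw hv ![z, 1, 1] x :=
    fun x => (unitaryHeckeEigencharacterAdic c hc1 v w hw hv ![z, 1, 1]).toLinearMap.map_smul _ x
  -- (first step as a TERM: a `rw` here would make `kabstract` compare the `GL₃` operator with the `U(3)` side — heartbeat blow-up)
  -- the `U(3)` side by explicit `RingHom`∕`LinearMap` laws (the generic `map_add`∕`map_smul` class searches time out on these carriers,
  -- cf. ★ p09 `bcGraphPartner_add`)
  have hadd := (unitaryHeckeEigencharacterAdic c hc1 v w hw hv ![z, 1, 1]).toRingHom.map_add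
    (((Nat.card 𝓀[K] : ℕ) : ℂ) • T₁) (((Nat.card 𝓀[K] : ℕ) : ℂ) • 1)
  have hone := (unitaryHeckeEigencharacterAdic c hc1 v w hw hv ![z, 1, 1]).toRingHom.map_one
  refine (glHeckeEigencharacter_bcLine_heckeDiag_one hϖ hu hwt z).trans (Eq.trans ?_ (hadd.trans (congrArg₂ (· + ·)
    ((hs T₁).trans (congrArg (((Nat.card 𝓀[K] : ℕ) : ℂ) • ·) hT)) ((hs 1).trans (congrArg (((Nat.card 𝓀[K] : ℕ) : ℂ) • ·) hone)))).symm)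
  rw [smul_eq_mul, smul_eq_mul]
  ring

/-- **(B.1′) `b T₁ = φ₁ + (Q − √Q + 1) • 1` in the RAW letters of the junction `K = L_w`**: `φ₁ = 1_{K₀ t K₀}` the basic operator of
★ `heckeEigencharacter_doubleCosetOperator_basic_three` (`λ_{(z,1,1)}(φ₁) = Q(z + z⁻¹) + √Q − 1`, `Q = #𝓀[E_w]`, `√Q = Nat.sqrt Q`, read at `w` through any unramified
datum `hd` by ★ `unitaryHeckeEigencharacterAdic_eq`, `σ_w ≠ id` by ★ `exists_galAdicCompletionMap_ne`), under the junction identity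
`hqQ : (#𝓀[K] : ℂ) = #𝓀[E_w]` of the two residue cardinalities (discharged at `K = L_w` by ★ `natCard_residueField_eq_of_compatible`): then
`Q(z + z⁻¹) + √Q − 1 + (Q − √Q + 1) = Q(z + 1 + z⁻¹) = λ^{GL₃}_{(z,1,z⁻¹)}(T₁)`.  This is the form the coefficient layer E1.4.4.2.3 cites.
[cite: Rogawski1990, §4.10 Prop. 4.10.2 p. 58] [cite: CartierCorvallis1979, §IV (4.2), Cor. 4.2] -/
theorem bcGraphPartnerAlgHom_heckeDiag_one_eq_basic {ϖ' : w.1.adicCompletion E}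
    (hd : UnramifiedLocalConjDatum (galAdicCompletionMap (L := E) c hw) ϖ')
    (hqQ : ((Nat.card 𝓀[K] : ℕ) : ℂ) = (Nat.card (Valued.ResidueField (w.1.adicCompletion E)) : ℂ)) :
    haveI := isHeckeTriple_unitaryInt_adicCompletion c v w hw ((StdForm.antidiagonal 3).over (w.1.adicCompletion E))
    bcGraphPartnerAlgHom c hc1 v w hw hv hϖ hu hwt
        (heckeAlgebra.doubleCosetOperator (glInt 3 K) (heckeDiag 3 (Units.mk0 ϖ hϖ.ne_zero) 1)) =
      heckeAlgebra.doubleCosetOperator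
          (unitaryInt (galAdicCompletionMap (L := E) c hw) ((StdForm.antidiagonal 3).over (w.1.adicCompletion E)))
          (⟨zpowDiagGL (uniformizer_ne_zero hd.vϖ) (fun i : Fin 3 => (1 : ℤ) * (1 - (i : ℕ))),
            zpowDiagGL_mem_unitaryGroupOfForm hd.σϖ _ (rev_linear_three 1)⟩ :
            ↥(unitaryGroupOfForm (galAdicCompletionMap (L := E) c hw) ((StdForm.antidiagonal 3).over (w.1.adicCompletion E)))) +
        ((Nat.card (Valued.ResidueField (w.1.adicCompletion E)) : ℂ) -
            (Nat.sqrt (Nat.card (Valued.ResidueField (w.1.adicCompletion E))) : ℂ) + 1) • 1 := by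
  haveI := isHeckeTriple_unitaryInt_adicCompletion c v w hw ((StdForm.antidiagonal 3).over (w.1.adicCompletion E))
  haveI := finite_residueField_adicCompletion E w.1
  refine (eq_bcGraphPartnerAlgHom_of_graph c hc1 v w hw hv hϖ hu hwt _ _ fun z => ?_).symm
  -- `λ_{(z,1,1)}(φ₁) = Q(z + z⁻¹) + √Q − 1` (★ `heckeEigencharacter_doubleCosetOperator_basic_three`, read through any datum `hd`)
  have hφ := (DFunLike.congr_fun (unitaryHeckeEigencharacterAdic_eq c hc1 v w hw hv hd ![z, 1, 1]) _).trans
    (hd.heckeEigencharacter_doubleCosetOperator_basic_three (exists_galAdicCompletionMap_ne c hc1 v w hw) ![z, 1, 1])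
  have hz : (((![z, 1, 1] : Fin 3 → ℂˣ) 0 : ℂˣ) : ℂ) * (((![z, 1, 1] : Fin 3 → ℂˣ) 2 : ℂˣ) : ℂ)⁻¹ = z := by simp
  rw [hz] at hφ
  have hone := (unitaryHeckeEigencharacterAdic c hc1 v w hw hv ![z, 1, 1]).toRingHom.map_one
  have hs : ∀ (r : ℂ) x, unitaryHeckeEigencharacterAdic c hc1 v w hw hv ![z, 1, 1] (r • x) =
      r • unitaryHeckeEigencharacterAdic c hc1 v w hw hv ![z, 1, 1] x :=
    fun r x => (unitaryHeckeEigencharacterAdic c hc1 v w hw hv ![z, 1, 1]).toLinearMap.map_smul r x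
  refine (glHeckeEigencharacter_bcLine_heckeDiag_one hϖ hu hwt z).trans (Eq.trans ?_
    (((unitaryHeckeEigencharacterAdic c hc1 v w hw hv ![z, 1, 1]).toRingHom.map_add _ _).trans
      (congrArg₂ (· + ·) hφ ((hs _ 1).trans (congrArg (_ • ·) hone)))).symm)
  rw [smul_eq_mul, mul_one, hqQ]
  ring

/-- **(B.2) `b T₂ = b T₁`**: `T₁` and `T₂` have the same eigencharacter on the base-change line ((G.1) = (G.2)), hence the same partner — `ψ̂_G` is far from
injective (`ℋ(GL₃) = ℂ[e₁, e₂, e₃^{±1}] ↠ ℂ[z + z⁻¹]`). [cite: Rogawski1990, §4.10 Prop. 4.10.2 p. 58] -/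
theorem bcGraphPartnerAlgHom_heckeDiag_two :
    bcGraphPartnerAlgHom c hc1 v w hw hv hϖ hu hwt
        (heckeAlgebra.doubleCosetOperator (glInt 3 K) (heckeDiag 3 (Units.mk0 ϖ hϖ.ne_zero) 2)) =
      bcGraphPartnerAlgHom c hc1 v w hw hv hϖ hu hwt
        (heckeAlgebra.doubleCosetOperator (glInt 3 K) (heckeDiag 3 (Units.mk0 ϖ hϖ.ne_zero) 1)) :=
  (eq_bcGraphPartnerAlgHom_of_graph c hc1 v w hw hv hϖ hu hwt _ _ fun z => by
    rw [glHeckeEigencharacter_bcLine_heckeDiag_two hϖ hu hwt, ← graph_bcGraphPartnerAlgHom c hc1 v w hw hv hϖ hu hwt,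
      glHeckeEigencharacter_bcLine_heckeDiag_one hϖ hu hwt]).symm

/-- **(B.3) `b T₃ = 1`**: the central operator has eigencharacter `1` on the line ((G.3)) and `λ^{U(3)}(1) = 1`. [cite: Rogawski1990, §4.10 Prop. 4.10.2 p. 58] -/
theorem bcGraphPartnerAlgHom_heckeDiag_three :
    bcGraphPartnerAlgHom c hc1 v w hw hv hϖ hu hwt
        (heckeAlgebra.doubleCosetOperator (glInt 3 K) (heckeDiag 3 (Units.mk0 ϖ hϖ.ne_zero) 3)) = 1 :=
  (eq_bcGraphPartnerAlgHom_of_graph c hc1 v w hw hv hϖ hu hwt _ _ fun z => by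
    rw [glHeckeEigencharacter_bcLine_heckeDiag_three hϖ hu hwt, map_one]).symm

/-- **(B.3′) `b T₃⁻¹ = 1`** for the inverse central operator `1_{K ϖ⁻¹ K}` (★ `SatakeGL.doubleCosetOperator_heckeDiag_self_mul_inv`: `T₃ · T₃⁻¹ = 1`, and `b` is an
algebra homomorphism with `b T₃ = 1`). [cite: Rogawski1990, §4.10 Prop. 4.10.2 p. 58] -/
theorem bcGraphPartnerAlgHom_heckeDiag_three_inv :
    bcGraphPartnerAlgHom c hc1 v w hw hv hϖ hu hwt
        (heckeAlgebra.doubleCosetOperator (glInt 3 K) (heckeDiag 3 (Units.mk0 ϖ hϖ.ne_zero) 3)⁻¹) = 1 := by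
  -- pure algebra on opaque letters (`map_eq_one_of_mul_eq_one`), so that no tactic compares the concrete operators
  exact map_eq_one_of_mul_eq_one (bcGraphPartnerAlgHom c hc1 v w hw hv hϖ hu hwt)
    (SatakeGL.doubleCosetOperator_heckeDiag_self_mul_inv (n := 3) (F := K) hϖ) (bcGraphPartnerAlgHom_heckeDiag_three c hc1 v w hw hv hϖ hu hwt)

end Partner


end Summit.HodgeConjecture.HodgeConjecture.R90.S6

end
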